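/-
Copyright (c) 2026. All rights reserved.
Released under Apache 2.0 license as described in the file LICENSE.
Authors: abc-iut cell, seat abc-iut-w6-d025 (gen 3; block C / W6, row «COR36-JOINT-TELE»).
-/
import Literature.AnabelianGeometry.AbsoluteAnabelian.DiagramOverTransport
import Literature.AnabelianGeometry.AbsoluteAnabelian.AbsTopIII.FrobeniusPictureMLFTelecoreOverE
import Literature.AnabelianGeometry.AbsoluteAnabelian.AbsTopIII.FrobeniusPictureMLFShiftTelecoreCompatible

/-!
# [AbsTopIII] Cor. 3.6 (ii)/(iii)/(v): the telecores `𝔗_An` over `𝒳` and over `ℰ` carry the SAME `𝒥`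

S. Mochizuki, *Topics in Absolute Anabelian Geometry III*, Cor. 3.6 (ii), (iii), (v) pp. 79–81 of the
kurims manuscript (`paper:url-5493eb38cbb7`; bib key `MochizukiAbsTopIII2015`); proof p. 81: "it is
immediate from the definitions — i.e., in essence, because the various Galois groups that appear remain
'undisturbed'".  Print speaks of ONE telecore `𝔗_An` with ONE contact structure `ℋ_An` in (ii), whose
family `𝒥` is the one (iii), second clause, and (v), fourth sentence, refer to.

In the cell's files the typed clauses were witnessed by TWO constructions of `𝔗_An` on the same diagram
`𝒟_An`: seat abc-iut-L4-t5's `anTelecore τ hν` (homotopies = lifts through structure functors over `𝒳`,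
`anOver`; witnesses of (ii) `telecoreStmt_of_coherent` and of (v) `shiftTelecoreCompatStmt_of_coherent`)
and this seat's `anTelecoreE τ` (lifts over `ℰ`, `teleOverE`; witness of the telecore half of (iii),
`logObsCompatTelecoreStmt_of_family'`) — seat abc-iut-L4-t10's joint-witness caveat F-L4t10g4-1.
This PROOF file removes the discrepancy:

* `κφXtoEIso`, `xtoE_map_η_app` — `(κ_An ⋙ φ_An) ⋙ (𝒳 → ℰ) ≅ 𝟭_ℰ`, and `(𝒳 → ℰ)(η_An,x)` IS that
  isomorphism at `(𝒳 → ℰ)(x)` (naturality of `η_An`: the one non-trivial square);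
* `anOverIsoE τ : OverIso ((anOver τ).map (𝒳 → ℰ)) (teleOverE τ)` — the structure functors over `𝒳`,
  pushed down to `ℰ`, are isomorphic to the structure functors over `ℰ` COMPATIBLY with every `μ_e`
  (`φ_An ⋙ (𝒳→ℰ) ≅ (Anab→ℰ)` at `Anab`, `(κ_An ⋙ φ_An) ⋙ (𝒳→ℰ) ≅ 𝟭` at `ℰ`/`𝒩`, unitors elsewhere);
* hence (toolkit `DiagramOverTransport`) the lifts into `Anab` AGREE (`an_lift_eq`), the universal
  families agree on the pairs through `Anab` (`anUnivE_η_eq`), and **`anTelecoreE_Jfam_eq :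
  (anTelecoreE τ).Jfam = (anTelecore τ hν).Jfam`**;
* so `ℋ_An = anContact τ hν` is a contact structure on `anTelecoreE τ` too, with the printed generator
  homotopies (`anContact_isContactAnE`), and the shifts `Ψ_m` are compatible with its `𝒥` and `ℋ_An`
  (`shiftTelecoreCompat_overE`): the (ii)- and (v)-fourth-sentence witnesses RE-WITNESSED at
  `anTelecoreE τ` (`joint_telecore_contact_shift_overE`; the ∃-statements `TelecoreStmt` /
  `ShiftTelecoreCompatStmt` themselves are already landed: `telecoreStmt_of_coherent`,
  `shiftTelecoreCompatStmt_of_coherent`) — the telecore at which the (iii)-telecore half is proved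
  (`logObsCompatTelecoreStmt_of_family'`, instantiated by seat abc-iut-L4-t10's
  `logObsCompatTelecoreStmt_of_glueCross`); the joint (ii) ∧ (iii) ∧ (v) form is then assembly.

Pure category theory over the abstract data (`Δ`, `τ`, `id_⋎` fully faithful, `τ` coherent); nothing here
takes a side on inter-universal Teichmüller theory or bears on [IUTchIII] Cor. 3.12; typed ≠ proved.
-/

namespace Literature.AnabelianGeometry.AbsoluteAnabelian

open _root_.CategoryTheory _root_.Quiver

universe u

namespace LogFrobeniusData

open DiagramOfCategories

variable (Δ : LogFrobeniusData.{u})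

/-! ### `(κ_An ⋙ φ_An) ⋙ (𝒳 → ℰ) ≅ 𝟭` and the naturality square of `η_An` -/

/-! ### Bookkeeping lemmas (all objects free; applied by `exact` to the unfolded components) -/

section Generic

variable {B C D : Type*} [Category B] [Category C] [Category D]

/-- [folklore] -/
private theorem g_id₃ {p q : C} {f g : p ⟶ q} (h : f = 𝟙 _ ≫ g ≫ 𝟙 _ ≫ 𝟙 _) : f = g := by
  simpa using h

/-- [folklore] -/
private theorem g_whisk (K : D ⥤ C) {p : C} {w w' : D} (i : p ⟶ K.obj w) (n : w ⟶ w') :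
    𝟙 _ ≫ i ≫ 𝟙 _ ≫ K.map (𝟙 w ≫ n) ≫ 𝟙 _ = i ≫ K.map n := by
  simp

/-- [folklore] -/
private theorem g_idL {p q r : C} (f : p ⟶ q) (g : q ⟶ r) : 𝟙 _ ≫ f ≫ g = f ≫ g := by
  simp

/-- [folklore] -/
private theorem g_unit (H : B ⥤ C) {b : B} {c : C} (k : H.obj b ⟶ c) : k = 𝟙 _ ≫ H.map (𝟙 b) ≫ k := by
  simp

/-- [folklore] -/
private theorem g_conj {p q r : C} {αi : q ⟶ p} {αh : p ⟶ q} (hα : αi ≫ αh = 𝟙 q) {u : p ⟶ p}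
    (hu : u = 𝟙 p) (k : q ⟶ r) : k = αi ≫ u ≫ 𝟙 p ≫ αh ≫ k := by
  subst hu
  simp [reassoc_of% hα]

/-- [folklore] -/
private theorem g_log (G : B ⥤ C) (H : C ⥤ D) {x x' : B} (f : x ⟶ x') :
    H.map (G.map f) ≫ 𝟙 _ = 𝟙 _ ≫ H.map (G.map f ≫ 𝟙 _) ≫ 𝟙 _ := by
  simp

/-- [folklore] -/
private theorem g_idsq (H : B ⥤ C) (b : B) : 𝟙 (H.obj b) = 𝟙 _ ≫ H.map (𝟙 b) ≫ 𝟙 _ := by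
  simp

/-- [folklore] -/
private theorem g_sq34 {T : C ⥤ C} (γ : T ≅ 𝟭 C) (z : C) {u : T.obj z ⟶ T.obj z} (hu : u = 𝟙 _) :
    𝟙 z = γ.inv.app z ≫ u ≫ 𝟙 _ ≫ γ.hom.app z ≫ 𝟙 _ := by
  subst hu
  simp only [Category.id_comp, Category.comp_id]
  exact (γ.inv_hom_id_app z).symm

/-- [folklore] -/
private theorem g_lam (K : B ⥤ C) {T : C ⥤ C} (γ : T ≅ 𝟭 C) {x₁ x₂ b : B} (h₂ : x₁ = x₂)
    (ηy : x₂ ⟶ b) {e₁ : C} (h : e₁ = K.obj b) (hK₁ : K.obj x₁ = T.obj e₁)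
    (hK₂ : K.obj x₂ = T.obj (K.obj b)) (hη : K.map ηy = eqToHom hK₂ ≫ γ.hom.app (K.obj b)) :
    eqToHom h = ((𝟙 _ ≫ γ.inv.app e₁) ≫ eqToHom hK₁.symm) ≫ K.map (eqToHom h₂ ≫ ηy) ≫
      𝟙 ((𝟭 C).obj (K.obj b)) := by
  subst h₂ h
  simp only [hη, Functor.id_obj, eqToHom_refl, Category.id_comp, Category.assoc, eqToHom_trans_assoc,
    Category.comp_id]
  exact (γ.inv_hom_id_app _).symm

/-- For a natural isomorphism `ε : T ≅ 𝟭`, `T(ε_x) = ε_{T x}` (naturality, `ε_x` mono). [folklore] -/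
private theorem map_hom_app_of_iso_id {T : C ⥤ C} (ε : T ≅ 𝟭 C) (x : C) :
    T.map (ε.hom.app x) = ε.hom.app (T.obj x) := by
  have h := ε.hom.naturality (ε.hom.app x)
  simp only [Functor.id_obj, Functor.id_map] at h
  exact (cancel_mono (ε.hom.app x)).mp h

/-- Bookkeeping: `g = (i ∘ f) ∘ h` from `i ∘ f ∘ h = g`. [folklore] -/
private theorem eq_comp_of_comp_eq {a b c d : C} {i : a ⟶ b} {f : b ⟶ c} {h : c ⟶ d} {g : a ⟶ d}
    (H : i ≫ f ≫ h = g) : g = (i ≫ f) ≫ h := by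
  rw [← H, Category.assoc]

end Generic

/-- `φ_An ∘ π_An ≅ 𝟭` read through `φ_An`: `φ_An(φπIsoId_a) = η_An,φ_An(a)` (defining property of the
preimage under the fully faithful `φ_An`). [cite: MochizukiAbsTopIII2015, Corollary 3.6 (ii) p.79] -/
theorem φ_map_φπIsoId_hom_app (a : Δ.A) :
    Δ.φ.map (Δ.φπIsoId.hom.app a) = Δ.η.hom.app (Δ.φ.obj a) := by
  have h := (Δ.ffφ'.whiskeringRight Δ.A).map_preimage
    (Functor.associator _ _ _ ≪≫ Functor.isoWhiskerLeft Δ.φ Δ.η ≪≫ Δ.φ.rightUnitor ≪≫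
      Δ.φ.leftUnitor.symm).hom
  exact g_id₃ (NatTrans.congr_app h a)

/-- Components of `φ_An ⋙ (𝒳 → ℰ) ≅ (Anab → ℰ)`: `κ_inv⁻¹` followed by `(Anab → ℰ)(φπIsoId)`.
[cite: MochizukiAbsTopIII2015, Corollary 3.6 (ii) p.79] -/
theorem φXtoEIsoAtoE_hom_app (a : Δ.A) :
    Δ.φXtoEIsoAtoE.hom.app a =
      Δ.κ_inv.inv.app (Δ.XtoE.obj (Δ.φ.obj a)) ≫ Δ.AtoE.map (Δ.φπIsoId.hom.app a) :=
  g_whisk Δ.AtoE _ _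

/-- **`(κ_An ⋙ φ_An) ⋙ (𝒳 → ℰ) ≅ 𝟭_ℰ`**: the structure functor of `ℰ` over `𝒳`, pushed down to `ℰ`, is
the identity (through `φ_An ⋙ (𝒳 → ℰ) ≅ (Anab → ℰ)` and `κ_An ⋙ (Anab → ℰ) ≅ 𝟭`).
[cite: MochizukiAbsTopIII2015, Corollary 3.6 (ii) p.79] -/
noncomputable def κφXtoEIso : (Δ.κ ⋙ Δ.φ) ⋙ Δ.XtoE ≅ 𝟭 Δ.E :=
  Functor.associator Δ.κ Δ.φ Δ.XtoE ≪≫ Functor.isoWhiskerLeft Δ.κ Δ.φXtoEIsoAtoE ≪≫ Δ.κ_inv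

/-- Components of `κφXtoEIso`. [cite: MochizukiAbsTopIII2015, Corollary 3.6 (ii) p.79] -/
theorem κφXtoEIso_hom_app (y : Δ.E) :
    Δ.κφXtoEIso.hom.app y = Δ.φXtoEIsoAtoE.hom.app (Δ.κ.obj y) ≫ Δ.κ_inv.hom.app y := by
  dsimp [κφXtoEIso]
  exact g_idL _ _

/-- `κ_An (𝒳→ℰ) (η_An,x) = φπIsoId_{κ_An (𝒳→ℰ) x}` (both map under the faithful `φ_An` to
`η_An,{φ_An π_An x}` by naturality of `η_An`). [cite: MochizukiAbsTopIII2015, Corollary 3.6 (ii) p.79] -/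
theorem κ_map_xtoE_map_η_app (x : Δ.X) :
    Δ.κ.map (Δ.XtoE.map (Δ.η.hom.app x)) = Δ.φπIsoId.hom.app (Δ.κ.obj (Δ.XtoE.obj x)) := by
  haveI := Δ.φ_equiv
  apply Δ.φ.map_injective
  have h₁ : Δ.φ.map (Δ.κ.map (Δ.XtoE.map (Δ.η.hom.app x))) =
      Δ.η.hom.app (Δ.φ.obj (Δ.κ.obj (Δ.XtoE.obj x))) :=
    map_hom_app_of_iso_id Δ.η x
  exact h₁.trans (Δ.φ_map_φπIsoId_hom_app _).symm

/-- **The naturality square of `η_An`**: `(𝒳 → ℰ)(η_An,x) = κφXtoEIso_{(𝒳→ℰ)(x)}` — the structure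
isomorphism of `λ^×`/`λ^{×pf}` over `𝒳` (`η_An`), pushed down to `ℰ`, is the comparison isomorphism.
[cite: MochizukiAbsTopIII2015, Corollary 3.6 (ii) p.80] -/
theorem xtoE_map_η_app (x : Δ.X) :
    Δ.XtoE.map (Δ.η.hom.app x) = Δ.κφXtoEIso.hom.app (Δ.XtoE.obj x) := by
  have nat := NatIso.naturality_1 Δ.κ_inv (Δ.XtoE.map (Δ.η.hom.app x))
  rw [κφXtoEIso_hom_app, φXtoEIsoAtoE_hom_app, ← κ_map_xtoE_map_η_app]
  exact eq_comp_of_comp_eq nat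

/-! ### The structure functors over `𝒳`, pushed down to `ℰ`, are those over `ℰ` -/

variable (τ : Δ.TelecoreData)

/-- The vertexwise isomorphisms `N^𝒳_v ⋙ (𝒳 → ℰ) ≅ N^ℰ_v` on `𝒟_An`: `φ_An ⋙ (𝒳→ℰ) ≅ (Anab→ℰ)` at `Anab`,
the identity on the first row, the unitor at `□`, `κφXtoEIso` (whiskered by `𝒩 → ℰ`) at `𝒩` and at `ℰ`.
[cite: MochizukiAbsTopIII2015, Corollary 3.6 (ii) p.80] -/
noncomputable def anOverβ : ∀ w : (teleShape anJ.{u}).Vertex,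
    ((Δ.anOver τ).map Δ.XtoE).N w ≅ (Δ.teleOverE τ).N w
  | ExtVertex.obs => Δ.φXtoEIsoAtoE
  | ExtVertex.base ⟨.row1 _, _⟩ => Iso.refl _
  | ExtVertex.base ⟨.nexus, _⟩ => Δ.XtoE.leftUnitor
  | ExtVertex.base ⟨.third, _⟩ =>
    Functor.associator Δ.NtoE (Δ.κ ⋙ Δ.φ) Δ.XtoE ≪≫ Functor.isoWhiskerLeft Δ.NtoE Δ.κφXtoEIso ≪≫
      Δ.NtoE.rightUnitor
  | ExtVertex.base ⟨.fourth, _⟩ => Δ.κφXtoEIso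
  | ExtVertex.base ⟨.fifth, _⟩ => Δ.φXtoEIsoAtoE
  | ExtVertex.base ⟨.sixth, _⟩ => Δ.κφXtoEIso

/-- **The structure functors of `𝒟_An` over `𝒳` (pushed down along `𝒳 → ℰ`) and over `ℰ` are
ISOMORPHIC STRUCTURE DATA**: the isomorphisms `anOverβ` are compatible with every `μ_e` — trivially on
`log`, `id_⋎`, `𝒩 → ℰ`, `κ_An`, `φ_⋏`; on `λ^×`/`λ^{×pf}` by the naturality square of `η_An`
(`xtoE_map_η_app`). [cite: MochizukiAbsTopIII2015, Corollary 3.6 (ii) p.80] -/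
noncomputable def anOverIsoE : OverData.OverIso ((Δ.anOver τ).map Δ.XtoE) (Δ.teleOverE τ) where
  β := Δ.anOverβ τ
  comm := by
    intro a b e y
    cases a with
    | obs =>
      cases b with
      | obs => exact PEmpty.elim e
      | base b =>
        obtain ⟨b, hb⟩ := b
        cases b with
        | row1 n => rfl -- telecore edge `φ_⋎ = φ₁`
        | nexus => exact g_unit Δ.XtoE _ -- telecore edge `φ_□ = φ_An`
        | third => exact PEmpty.elim e
        | fourth => exact PEmpty.elim e
        | fifth => exact PEmpty.elim e
        | sixth => exact PEmpty.elim e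
    | base a =>
      obtain ⟨a, ha⟩ := a
      cases b with
      | obs =>
        cases a with
        | fourth => -- observation edge `κ_An`
          exact g_conj (Iso.inv_hom_id_app Δ.φXtoEIsoAtoE _) (Δ.XtoE.map_id _) _
        | row1 n => exact PEmpty.elim e
        | nexus => exact PEmpty.elim e
        | third => exact PEmpty.elim e
        | fifth => exact PEmpty.elim e
        | sixth => exact PEmpty.elim e
      | base b =>
        obtain ⟨b, hb⟩ := b
        cases a with
        | row1 m =>
          cases b with
          | row1 n => exact g_log Δ.toNexus Δ.XtoE _ -- `log`
          | nexus => exact g_idsq Δ.XtoE _ -- `id_⋎`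
          | third => exact PEmpty.elim e
          | fourth => exact PEmpty.elim e
          | fifth => exact PEmpty.elim e
          | sixth => exact PEmpty.elim e
        | nexus =>
          cases b with
          | third =>
            -- `λ^×` / `λ^{×pf}`: the naturality square of `η_An`
            obtain ⟨_ | _⟩ := e
            · have HX : Δ.lamPf ⋙ (Δ.NtoE ⋙ Δ.κ ⋙ Δ.φ) = Δ.XtoE ⋙ Δ.κ ⋙ Δ.φ := by
                rw [← Functor.assoc, Δ.lamPf_NtoE]
              change Δ.X at y
              change (eqToHom Δ.lamPf_NtoE).app y =
                ((𝟙 _ ≫ Δ.κφXtoEIso.inv.app (Δ.NtoE.obj (Δ.lamPf.obj y))) ≫ 𝟙 _) ≫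
                  Δ.XtoE.map ((eqToHom HX).app y ≫ Δ.η.hom.app y) ≫ 𝟙 _
              rw [eqToHom_app, eqToHom_app]
              exact g_lam Δ.XtoE Δ.κφXtoEIso (Functor.congr_obj HX y) (Δ.η.hom.app y)
                (Functor.congr_obj Δ.lamPf_NtoE y) rfl rfl (by
                  change Δ.XtoE.map (Δ.η.hom.app y) = 𝟙 _ ≫ Δ.κφXtoEIso.hom.app (Δ.XtoE.obj y)
                  simpa using Δ.xtoE_map_η_app y)
            · have HX : Δ.lamTimes ⋙ (Δ.NtoE ⋙ Δ.κ ⋙ Δ.φ) = Δ.XtoE ⋙ Δ.κ ⋙ Δ.φ := by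
                rw [← Functor.assoc, Δ.lamTimes_NtoE]
              change Δ.X at y
              change (eqToHom Δ.lamTimes_NtoE).app y =
                ((𝟙 _ ≫ Δ.κφXtoEIso.inv.app (Δ.NtoE.obj (Δ.lamTimes.obj y))) ≫ 𝟙 _) ≫
                  Δ.XtoE.map ((eqToHom HX).app y ≫ Δ.η.hom.app y) ≫ 𝟙 _
              rw [eqToHom_app, eqToHom_app]
              exact g_lam Δ.XtoE Δ.κφXtoEIso (Functor.congr_obj HX y) (Δ.η.hom.app y)
                (Functor.congr_obj Δ.lamTimes_NtoE y) rfl rfl (by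
                  change Δ.XtoE.map (Δ.η.hom.app y) = 𝟙 _ ≫ Δ.κφXtoEIso.hom.app (Δ.XtoE.obj y)
                  simpa using Δ.xtoE_map_η_app y)
          | row1 n => exact PEmpty.elim e
          | nexus => exact PEmpty.elim e
          | fourth => exact PEmpty.elim e
          | fifth => exact PEmpty.elim e
          | sixth => exact PEmpty.elim e
        | third =>
          cases b with
          | fourth => exact g_sq34 Δ.κφXtoEIso _ (Δ.XtoE.map_id _) -- `𝒩 → ℰ`
          | row1 n => exact PEmpty.elim e
          | nexus => exact PEmpty.elim e
          | third => exact PEmpty.elim e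
          | fifth => exact PEmpty.elim e
          | sixth => exact PEmpty.elim e
        | fourth =>
          cases b with
          | fifth => exact (not_fifth_le_four hb).elim
          | row1 n => exact PEmpty.elim e
          | nexus => exact PEmpty.elim e
          | third => exact PEmpty.elim e
          | fourth => exact PEmpty.elim e
          | sixth => exact PEmpty.elim e
        | fifth => exact (not_fifth_le_four ha).elim
        | sixth =>
          cases b with
          | row1 n => exact PEmpty.elim e
          | nexus => exact PEmpty.elim e
          | third => exact PEmpty.elim e
          | fourth => exact PEmpty.elim e
          | fifth => exact PEmpty.elim e
          | sixth => exact PEmpty.elim e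

/-! ### The lifts, the universal families and the telecore families agree -/

/-- **The lifts into `Anab` over `𝒳` and over `ℰ` agree** (every over-`𝒳` homotopy is over `ℰ`;
uniqueness at the fully faithful `Anab → ℰ`). [cite: MochizukiAbsTopIII2015, Remark 3.5.1 p.78] -/
theorem an_lift_eq {a w : (teleShape anJ.{u}).Vertex} (hw : anW w) (hw' : w = (teleShape anJ.{u}).obs)
    (hν : Δ.toNexus.FullyFaithful) (p q : Path a w) :
    (Δ.anOver τ).lift (Δ.anFF τ hν w hw) p q = (Δ.teleOverE τ).lift (Δ.anFFE τ w hw') p q :=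
  OverData.lift_eq_of_map_overIso Δ.XtoE (Δ.anOverIsoE τ) _ _ p q

/-- The boundary set of the universal family over `ℰ` (pairs through `Anab`) lies in that of the
universal family over `𝒳` (pairs through any vertex but `𝒩`). [cite: MochizukiAbsTopIII2015, Definition 3.5 (iv) p.76] -/
theorem anUnivE_E_sub (hν : Δ.toNexus.FullyFaithful) {a b : (teleShape anJ.{u}).Vertex} {P Q : Path a b} (h : (Δ.anUnivE τ).E P Q) :
    (Δ.anUniv τ hν).E P Q :=
  univE_mono (fun w hw => by subst hw; trivial) h

/-- **The universal families over `𝒳` and over `ℰ` agree on the pairs through `Anab`.**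
[cite: MochizukiAbsTopIII2015, Definition 3.5 (ii) p.75] -/
theorem anUnivE_η_eq (hν : Δ.toNexus.FullyFaithful) {a b : (teleShape anJ.{u}).Vertex} {P Q : Path a b} (h : (Δ.anUnivE τ).E P Q) :
    (Δ.anUnivE τ).η h = (Δ.anUniv τ hν).η (Δ.anUnivE_E_sub τ hν h) := by
  obtain ⟨⟨w, hw, p, q, s, hl, hr⟩⟩ := h
  rw [Δ.anUnivE_η_eq_decomp τ _ ⟨w, hw, p, q, s, hl, hr⟩,
    Δ.anUniv_η_eq_decomp τ hν _ ⟨w, (by subst hw; trivial), p, q, s, hl, hr⟩]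
  subst hw
  simp only [Decomp.η]
  rw [Δ.an_lift_eq τ (w := (teleShape anJ.{u}).obs) trivial rfl hν p q]

/-- **The telecore families agree: `𝒥(𝔗_An over ℰ) = 𝒥(𝔗_An over 𝒳)`** — same diagram `𝒟_An`, same
boundary set (the pairs `([γ₃]∘[γ₁], [γ₃]∘[γ₂])` through `Anab`), same homotopies.
[cite: MochizukiAbsTopIII2015, Corollary 3.6 (ii) p.79] -/
theorem anTelecoreE_Jfam_eq (hν : Δ.toNexus.FullyFaithful) : (Δ.anTelecoreE τ).Jfam = (Δ.anTelecore τ hν).Jfam :=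
  HomotopyFamily.restrictBoundary_eq_restrictBoundary fun _ _ _ _ h => Δ.anUnivE_η_eq τ hν h

/-! ### `ℋ_An` is a contact structure on `𝔗_An` over `ℰ`; Cor. 3.6 (ii) and (v) re-witnessed there -/

/-- `ℋ_An` is a contact structure for the telecore over `ℰ` (compatible with its `𝒥`, which is the `𝒥`
over `𝒳`). [cite: MochizukiAbsTopIII2015, Corollary 3.6 (ii) p.80] -/
theorem anContact_isContactStructureE (hν : Δ.toNexus.FullyFaithful) :
    Telecore.IsContactStructure (Δ.sub 4) (Δ.anTelecoreE τ) (Δ.anContact τ hν) := by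
  have h := Δ.anContact_isContactStructure τ hν
  unfold Telecore.IsContactStructure at h ⊢
  rw [Δ.anTelecoreE_Jfam_eq τ hν]
  exact h

/-- **`ℋ_An` IS the contact structure of Cor. 3.6 (ii) ON THE TELECORE OVER `ℰ`**: compatible with `𝒥`,
generated by the printed pairs, with the printed homotopies `η_{□⋎} = e⁻¹`, `η_□ = η_An`, `η_⋎ = η₁` on the
generators (for coherent `τ`). [cite: MochizukiAbsTopIII2015, Corollary 3.6 (ii) pp.79–80] -/
theorem anContact_isContactAnE (hν : Δ.toNexus.FullyFaithful)
    (hτ : ∀ x : Δ.X₁, Δ.toNexus.map (τ.η₁.hom.app x) =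
      τ.e.hom.app (Δ.κ.obj (Δ.XtoE.obj (Δ.toNexus.obj x))) ≫ Δ.η.hom.app (Δ.toNexus.obj x)) :
    Δ.IsContactAn τ (Δ.anTelecoreE τ) (Δ.anContact τ hν) :=
  ⟨Δ.anContact_isContactStructureE τ hν, Δ.anContact_isGeneratedBy τ hν,
    fun n j jn h a e₁ e₂ => Δ.anContact_etaSq τ hν n j jn h a e₁ e₂,
    fun j h x e₁ e₂ => Δ.anContact_etaNexus τ hν j h x e₁ e₂,
    fun n jn h x e₁ e₂ => Δ.anContact_etaRow1 τ hν hτ n jn h x e₁ e₂⟩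

/-- **The shifts `Ψ_m` are compatible with `𝒥` of the telecore over `ℰ` and with `ℋ_An`** (Cor. 3.6 (v),
fourth sentence, at `anTelecoreE τ`: this seat's `nonempty_compatibleWith_Jfam` transported along
`anTelecoreE_Jfam_eq`). [cite: MochizukiAbsTopIII2015, Corollary 3.6 (v) p.80] -/
theorem shiftTelecoreCompat_overE (hν : Δ.toNexus.FullyFaithful) (m : ℤ) :
    Nonempty ((Δ.teleShiftEquiv τ m).hom.CompatibleWith (Δ.anTelecoreE τ).Jfam (Δ.anTelecoreE τ).Jfam) ∧
      Nonempty ((Δ.teleShiftEquiv τ m).hom.CompatibleWith (Δ.anContact τ hν) (Δ.anContact τ hν)) := by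
  rw [Δ.anTelecoreE_Jfam_eq τ hν]
  exact ⟨Δ.nonempty_compatibleWith_Jfam τ hν m, Δ.nonempty_compatibleWith_anContact τ hν m⟩

/-- **Joint witness for Cor. 3.6 (ii) ∧ (v)-fourth-sentence at ONE telecore — the telecore of the
(iii) witness**: `𝔗_An` over `ℰ` has the printed shape, carries `ℋ_An` with the printed generator
homotopies, and every `Ψ_m` is compatible with its `𝒥` and with `ℋ_An`.
[cite: MochizukiAbsTopIII2015, Corollary 3.6 (ii)/(v) pp.79–80] -/
theorem joint_telecore_contact_shift_overE (hν : Δ.toNexus.FullyFaithful)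
    (hτ : ∀ x : Δ.X₁, Δ.toNexus.map (τ.η₁.hom.app x) =
      τ.e.hom.app (Δ.κ.obj (Δ.XtoE.obj (Δ.toNexus.obj x))) ≫ Δ.η.hom.app (Δ.toNexus.obj x)) :
    Δ.IsTelecoreAn τ (Δ.anTelecoreE τ) ∧ Δ.IsContactAn τ (Δ.anTelecoreE τ) (Δ.anContact τ hν) ∧
      ∀ m : ℤ,
        Nonempty ((Δ.teleShiftEquiv τ m).hom.CompatibleWith (Δ.anTelecoreE τ).Jfam (Δ.anTelecoreE τ).Jfam) ∧
        Nonempty ((Δ.teleShiftEquiv τ m).hom.CompatibleWith (Δ.anContact τ hν) (Δ.anContact τ hν)) :=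
  ⟨Δ.anTelecoreE_isTelecoreAn τ, Δ.anContact_isContactAnE τ hν hτ, fun m => Δ.shiftTelecoreCompat_overE τ hν m⟩

end LogFrobeniusData

end Literature.AnabelianGeometry.AbsoluteAnabelian
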